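import Summits.KontsevichZagierPeriods.KontsevichZagierPeriods.Theorems.LinRedNormalFormArrangementNormalFormSeparateThreeHIFibres

/-!
# Directions at a rim vertex on the pole plane: empty, thick, moderate and rim directions

(Line `janus-bands`, crux `ArrangementNormalForm`, stub `stub_separateThreeZero`, part
`HIDirections` of the termwise numerator split `separateThree_hI` under the rim condition.)

At a rim point `(v₀, 0)` of the closed cell on the pole plane the cone fibre `Kfib u` over the
base displacement `u` depends, up to the dilation by `‖u‖`, only on the direction `‖u‖⁻¹ • u`
(`Kfib_dir`). The behaviour of the Taylor pieces over `v₀ + u` is governed by the type of that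
direction `d` (`‖d‖ = 1`), read off from the heights `hlo d ≤ hhi d` of the cone fibre:
* EMPTY directions (an active vertical constraint negative at `d`, or `hhi d < hlo d`): the cone
  fibres over all nearby directions are empty (`dir_empty`);
* THICK directions (`hlo d = 0 < hhi d`): nearby fibres start below half their top (`dir_thick`);
* MODERATE directions (`0 < hlo d < hhi d`): nearby fibres contain a fixed dilated interval and lie
  in a fixed dilated window away from the pole plane (`dir_moderate`);
* RIM directions (`0 < hlo d = hhi d`): nearby fibres lie in a fixed dilated window away from
  the pole plane (`dir_rim`);
* CONTACT directions (`hlo d = hhi d = 0`): part `HIContact`.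
`dir_cases` (registered as `separateThree_directions`) is the exhaustion of the unit directions by
these five types.
-/

noncomputable section

open Set Filter Topology

namespace Summit.KontsevichZagierPeriods.ArrangementNormalForm.JanusBands

namespace SepThree

section Directions

variable {J : ℕ} (g : Fin J → Con) (v₀ : Fin 2 → ℝ)
  (hB : (bots g v₀).Nonempty) (hT : (tops g v₀).Nonempty)

/-! ### Dilation of the cone fibres -/

/-- The direction of a non-zero base displacement. -/
def udir (u : Fin 2 → ℝ) : Fin 2 → ℝ := ‖u‖⁻¹ • u

/-- The direction has unit norm. -/
theorem norm_dir {u : Fin 2 → ℝ} (hu : u ≠ 0) : ‖udir u‖ = 1 := norm_smul_inv_norm hu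

/-- A displacement is its norm times its direction. -/
theorem norm_smul_dir {u : Fin 2 → ℝ} (hu : u ≠ 0) : ‖u‖ • udir u = u :=
  smul_inv_smul₀ (norm_ne_zero_iff.2 hu) u

include hB in
/-- `hlo` along a displacement is the dilated `hlo` of its direction. -/
theorem hlo_eq_dir {u : Fin 2 → ℝ} (hu : u ≠ 0) : hlo g v₀ hB u = ‖u‖ * hlo g v₀ hB (udir u) := by
  conv_lhs => rw [← norm_smul_dir hu]
  exact hlo_smul g v₀ hB (norm_nonneg u) (udir u)

include hT in
/-- `hhi` along a displacement is the dilated `hhi` of its direction. -/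
theorem hhi_eq_dir {u : Fin 2 → ℝ} (hu : u ≠ 0) : hhi g v₀ hT u = ‖u‖ * hhi g v₀ hT (udir u) := by
  conv_lhs => rw [← norm_smul_dir hu]
  exact hhi_smul g v₀ hT (norm_nonneg u) (udir u)

/-- Admissibility by the vertical constraints depends only on the direction. -/
theorem vert_iff_dir {u : Fin 2 → ℝ} (hu : u ≠ 0) : vert g v₀ u ↔ vert g v₀ (udir u) := by
  have hn : 0 < ‖u‖ := norm_pos_iff.2 hu
  unfold vert
  constructor
  · intro h j hj hc
    have := h j hj hc
    rw [← norm_smul_dir hu, blin_smul] at this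
    exact pos_of_mul_pos_right this hn.le
  · intro h j hj hc
    rw [← norm_smul_dir hu, blin_smul]
    exact mul_pos hn (h j hj hc)

include hB hT in
/-- **The cone fibre is the dilated fibre of the direction**, over admissible displacements. -/
theorem Kfib_dir {u : Fin 2 → ℝ} (hu : u ≠ 0) (hv : vert g v₀ u) :
    Kfib g v₀ u = Ioo (‖u‖ * hlo g v₀ hB (udir u)) (‖u‖ * hhi g v₀ hT (udir u)) := by
  rw [Kfib_eq_Ioo g v₀ hB hT hv, hlo_eq_dir g v₀ hB hu, hhi_eq_dir g v₀ hT hu]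

/-- The distance to a direction is the norm of the difference. -/
theorem dist_dir_eq (u d : Fin 2 → ℝ) : dist (udir u) d = ‖udir u - d‖ := dist_eq_norm _ _

/-! ### Empty directions -/

include hB hT in
/-- **Empty directions.** If an active vertical constraint is negative at `d`, or `hhi d < hlo d`,
then the cone fibres over all displacements with direction near `d` are empty. -/
theorem dir_empty {d : Fin 2 → ℝ}
    (h : (∃ j ∈ act g v₀, (g j).2.1 = 0 ∧ blin (g j) d < 0) ∨ hhi g v₀ hT d < hlo g v₀ hB d) :
    ∃ ε > 0, ∀ u : Fin 2 → ℝ, u ≠ 0 → ‖udir u - d‖ < ε → Kfib g v₀ u = ∅ := by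
  rcases h with ⟨j, hj, hc, hneg⟩ | hlt
  · have hev : ∀ᶠ x in 𝓝 d, blin (g j) x < 0 :=
      ((continuous_blin (g j)).tendsto d).eventually_lt_const hneg
    obtain ⟨ε, hε, hball⟩ := Metric.eventually_nhds_iff.1 hev
    refine ⟨ε, hε, fun u hu hud => eq_empty_of_forall_notMem fun t ht => ?_⟩
    have hdir : blin (g j) (udir u) < 0 := hball (by rw [dist_dir_eq]; exact hud)
    have := ht j hj
    rw [clin_eq, hc, zero_mul, add_zero, ← norm_smul_dir hu, blin_smul] at this
    have hn : 0 < ‖u‖ := norm_pos_iff.2 hu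
    nlinarith
  · have hev : ∀ᶠ x in 𝓝 d, hhi g v₀ hT x < hlo g v₀ hB x :=
      (continuous_hhi g v₀ hT).continuousAt.eventually_lt (continuous_hlo g v₀ hB).continuousAt hlt
    obtain ⟨ε, hε, hball⟩ := Metric.eventually_nhds_iff.1 hev
    refine ⟨ε, hε, fun u hu hud => eq_empty_of_forall_notMem fun t ht => ?_⟩
    have hdir : hhi g v₀ hT (udir u) < hlo g v₀ hB (udir u) := hball (by rw [dist_dir_eq]; exact hud)
    obtain ⟨h1, h2, -⟩ := (mem_Kfib_iff g v₀ hB hT u t).1 ht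
    rw [hlo_eq_dir g v₀ hB hu] at h1
    rw [hhi_eq_dir g v₀ hT hu] at h2
    have hn : 0 < ‖u‖ := norm_pos_iff.2 hu
    nlinarith

/-! ### Thick directions -/

include hB hT in
/-- **Thick directions.** If `hlo d = 0 < hhi d`, the non-empty cone fibres over displacements
with direction near `d` are intervals `(lo, hi)` with `0 ≤ lo ≤ hi / 2`. -/
theorem dir_thick (hcl : ((v₀, 0) : (Fin 2 → ℝ) × ℝ) ∈ closure (Om3 g))
    (hup : ∀ p ∈ closure (Om3 g), 0 ≤ p.2) {d : Fin 2 → ℝ}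
    (h1 : hlo g v₀ hB d = 0) (h2 : 0 < hhi g v₀ hT d) :
    ∃ ε > 0, ∀ u : Fin 2 → ℝ, u ≠ 0 → ‖udir u - d‖ < ε → (Kfib g v₀ u).Nonempty →
      Kfib g v₀ u = Ioo (hlo g v₀ hB u) (hhi g v₀ hT u) ∧ 0 ≤ hlo g v₀ hB u ∧
        hlo g v₀ hB u ≤ (1 / 2) * hhi g v₀ hT u := by
  set H := hhi g v₀ hT d with hH
  have hev : ∀ᶠ x in 𝓝 d, hlo g v₀ hB x < H / 4 ∧ H / 2 < hhi g v₀ hT x := by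
    refine (((continuous_hlo g v₀ hB).tendsto d).eventually_lt_const (by rw [h1]; positivity)).and ?_
    exact ((continuous_hhi g v₀ hT).tendsto d).eventually_const_lt (by rw [hH]; linarith)
  obtain ⟨ε, hε, hball⟩ := Metric.eventually_nhds_iff.1 hev
  refine ⟨ε, hε, fun u hu hud hne => ?_⟩
  obtain ⟨hlo', hhi'⟩ := hball (show dist (udir u) d < ε by rw [dist_dir_eq]; exact hud)
  have hv := vert_of_nonempty g v₀ hne
  refine ⟨Kfib_eq_Ioo g v₀ hB hT hv, hlo_nonneg g v₀ hB hT hcl hup hne, ?_⟩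
  rw [hlo_eq_dir g v₀ hB hu, hhi_eq_dir g v₀ hT hu]
  have hn : 0 < ‖u‖ := norm_pos_iff.2 hu
  nlinarith

/-! ### Moderate directions -/

include hB hT in
/-- **Moderate directions.** If `0 < hlo d < hhi d`, the non-empty cone fibres over displacements
`u` with direction near `d` contain the dilated interval `‖u‖ [a₀, b₀]` and lie in the dilated
window `‖u‖ (A₁, B₁)`, for fixed `0 < A₁ < a₀ < b₀ < B₁`. -/
theorem dir_moderate {d : Fin 2 → ℝ} (h1 : 0 < hlo g v₀ hB d) (h2 : hlo g v₀ hB d < hhi g v₀ hT d) :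
    ∃ ε > 0, ∃ a₀ b₀ A₁ B₁ : ℝ, 0 < A₁ ∧ A₁ < a₀ ∧ a₀ < b₀ ∧ b₀ < B₁ ∧
      ∀ u : Fin 2 → ℝ, u ≠ 0 → ‖udir u - d‖ < ε → (Kfib g v₀ u).Nonempty →
        Icc (‖u‖ * a₀) (‖u‖ * b₀) ⊆ Kfib g v₀ u ∧ Kfib g v₀ u ⊆ Ioo (‖u‖ * A₁) (‖u‖ * B₁) := by
  set L := hlo g v₀ hB d with hL
  set H := hhi g v₀ hT d with hH
  set η := min ((H - L) / 4) (L / 2) with hη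
  have hη0 : 0 < η := lt_min (by linarith) (by linarith)
  have hη1 : η ≤ (H - L) / 4 := min_le_left _ _
  have hη2 : η ≤ L / 2 := min_le_right _ _
  have hev : ∀ᶠ x in 𝓝 d, (L - η < hlo g v₀ hB x ∧ hlo g v₀ hB x < L + η) ∧
      (H - η < hhi g v₀ hT x ∧ hhi g v₀ hT x < H + η) := by
    refine ((((continuous_hlo g v₀ hB).tendsto d).eventually_const_lt (by linarith)).and
      (((continuous_hlo g v₀ hB).tendsto d).eventually_lt_const (by linarith))).and ?_
    exact (((continuous_hhi g v₀ hT).tendsto d).eventually_const_lt (by linarith)).and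
      (((continuous_hhi g v₀ hT).tendsto d).eventually_lt_const (by linarith))
  obtain ⟨ε, hε, hball⟩ := Metric.eventually_nhds_iff.1 hev
  refine ⟨ε, hε, L + η, H - η, L - η, H + η, by linarith, by linarith, by linarith, by linarith,
    fun u hu hud hne => ?_⟩
  obtain ⟨⟨hl1, hl2⟩, ⟨hh1, hh2⟩⟩ := hball (show dist (udir u) d < ε by rw [dist_dir_eq]; exact hud)
  have hv := vert_of_nonempty g v₀ hne
  have hn : 0 < ‖u‖ := norm_pos_iff.2 hu
  rw [Kfib_dir g v₀ hB hT hu hv]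
  constructor
  · intro t ht
    exact ⟨lt_of_lt_of_le (mul_lt_mul_of_pos_left hl2 hn) ht.1,
      lt_of_le_of_lt ht.2 (mul_lt_mul_of_pos_left hh1 hn)⟩
  · exact Ioo_subset_Ioo (mul_le_mul_of_nonneg_left hl1.le hn.le)
      (mul_le_mul_of_nonneg_left hh2.le hn.le)

/-! ### Rim directions -/

include hB hT in
/-- **Rim directions.** If `0 < hlo d = hhi d`, the cone fibres over displacements `u` with
direction near `d` lie in the dilated window `‖u‖ (A₁, B₁)`, for fixed `0 < A₁ < B₁`. -/
theorem dir_rim {d : Fin 2 → ℝ} (h1 : 0 < hlo g v₀ hB d) (h2 : hlo g v₀ hB d = hhi g v₀ hT d) :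
    ∃ ε > 0, ∃ A₁ B₁ : ℝ, 0 < A₁ ∧ A₁ < B₁ ∧
      ∀ u : Fin 2 → ℝ, u ≠ 0 → ‖udir u - d‖ < ε → Kfib g v₀ u ⊆ Ioo (‖u‖ * A₁) (‖u‖ * B₁) := by
  set L := hlo g v₀ hB d with hL
  have hev : ∀ᶠ x in 𝓝 d, L / 2 < hlo g v₀ hB x ∧ hhi g v₀ hT x < 2 * L :=
    (((continuous_hlo g v₀ hB).tendsto d).eventually_const_lt (by linarith)).and
      (((continuous_hhi g v₀ hT).tendsto d).eventually_lt_const (by rw [← h2]; linarith))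
  obtain ⟨ε, hε, hball⟩ := Metric.eventually_nhds_iff.1 hev
  refine ⟨ε, hε, L / 2, 2 * L, by linarith, by linarith, fun u hu hud t ht => ?_⟩
  obtain ⟨hl, hh⟩ := hball (show dist (udir u) d < ε by rw [dist_dir_eq]; exact hud)
  obtain ⟨ht1, ht2, -⟩ := (mem_Kfib_iff g v₀ hB hT u t).1 ht
  rw [hlo_eq_dir g v₀ hB hu] at ht1
  rw [hhi_eq_dir g v₀ hT hu] at ht2
  have hn : 0 < ‖u‖ := norm_pos_iff.2 hu
  constructor <;> nlinarith

/-! ### The exhaustion of the directions -/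

include hB hT in
/-- **The five types of directions.** At a rim point on the pole plane with the closed cell above
the pole plane, every direction is empty, thick, moderate, rim or contact. -/
theorem dir_cases (hcl : ((v₀, 0) : (Fin 2 → ℝ) × ℝ) ∈ closure (Om3 g))
    (hup : ∀ p ∈ closure (Om3 g), 0 ≤ p.2) (d : Fin 2 → ℝ) :
    ((∃ j ∈ act g v₀, (g j).2.1 = 0 ∧ blin (g j) d < 0) ∨ hhi g v₀ hT d < hlo g v₀ hB d) ∨
    (hlo g v₀ hB d = 0 ∧ 0 < hhi g v₀ hT d) ∨
    (0 < hlo g v₀ hB d ∧ hlo g v₀ hB d < hhi g v₀ hT d) ∨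
    (0 < hlo g v₀ hB d ∧ hlo g v₀ hB d = hhi g v₀ hT d) ∨
    (hlo g v₀ hB d = 0 ∧ hhi g v₀ hT d = 0) := by
  by_cases hv : ∃ j ∈ act g v₀, (g j).2.1 = 0 ∧ blin (g j) d < 0
  · exact Or.inl (Or.inl hv)
  by_cases hlt : hhi g v₀ hT d < hlo g v₀ hB d
  · exact Or.inl (Or.inr hlt)
  push Not at hv hlt
  -- the closed cone fibre over `d` is `[hlo d, hhi d] ≠ ∅`, hence `0 ≤ hlo d`
  have hnn : 0 ≤ hlo g v₀ hB d := by
    refine snd_nonneg_of_active_nonneg g v₀ hcl hup (d, hlo g v₀ hB d) fun j hj => ?_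
    rcases lt_trichotomy 0 ((g j).2.1) with hc | hc | hc
    · rw [clin_eq_mul_sub _ _ _ hc.ne']
      refine mul_nonneg hc.le (sub_nonneg.2 ?_)
      exact Finset.le_sup' (fun j => hgt (g j) d) ((mem_bots g v₀).2 ⟨hj, hc⟩)
    · rw [clin_eq, ← hc, zero_mul, add_zero]
      exact hv j hj hc.symm
    · rw [clin_eq_mul_sub _ _ _ hc.ne]
      refine mul_nonneg_of_nonpos_of_nonpos hc.le (sub_nonpos.2 (hlt.trans ?_))
      exact Finset.inf'_le (fun j => hgt (g j) d) ((mem_tops g v₀).2 ⟨hj, hc⟩)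
  rcases hnn.lt_or_eq with hpos | hzero
  · rcases hlt.lt_or_eq with h | h
    · exact Or.inr (Or.inr (Or.inl ⟨hpos, h⟩))
    · exact Or.inr (Or.inr (Or.inr (Or.inl ⟨hpos, h⟩)))
  · rcases hlt.lt_or_eq with h | h
    · exact Or.inr (Or.inl ⟨hzero.symm, by rw [hzero]; exact h⟩)
    · exact Or.inr (Or.inr (Or.inr (Or.inr ⟨hzero.symm, by rw [← h, hzero]⟩)))

end Directions

end SepThree

/-- **The five types of directions at a rim point on the pole plane** (registered part of
`stub_separateThreeZero`; literal form of `SepThree.dir_cases`): with the closed cell above the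
pole plane, every base direction `d` is EMPTY (an active vertical constraint negative at `d`, or
`hhi d < hlo d`), THICK (`hlo d = 0 < hhi d`), MODERATE (`0 < hlo d < hhi d`), RIM
(`0 < hlo d = hhi d`) or CONTACT (`hlo d = hhi d = 0`). -/
theorem separateThree_directions {J : ℕ} (g : Fin J → (Fin 2 → ℝ) × ℝ × ℝ) (v₀ : Fin 2 → ℝ) (hB : (SepThree.bots g v₀).Nonempty) (hT : (SepThree.tops g v₀).Nonempty) (hcl : ((v₀, 0) : (Fin 2 → ℝ) × ℝ) ∈ closure (SepThree.Om3 g)) (hup : ∀ p ∈ closure (SepThree.Om3 g), 0 ≤ p.2) (d : Fin 2 → ℝ) : ((∃ j ∈ SepThree.act g v₀, (g j).2.1 = 0 ∧ SepThree.blin (g j) d < 0) ∨ SepThree.hhi g v₀ hT d < SepThree.hlo g v₀ hB d) ∨ (SepThree.hlo g v₀ hB d = 0 ∧ 0 < SepThree.hhi g v₀ hT d) ∨ (0 < SepThree.hlo g v₀ hB d ∧ SepThree.hlo g v₀ hB d < SepThree.hhi g v₀ hT d) ∨ (0 < SepThree.hlo g v₀ hB d ∧ SepThree.hlo g v₀ hB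 d = SepThree.hhi g v₀ hT d) ∨ (SepThree.hlo g v₀ hB d = 0 ∧ SepThree.hhi g v₀ hT d = 0) := by
  exact SepThree.dir_cases g v₀ hB hT hcl hup d

end Summit.KontsevichZagierPeriods.ArrangementNormalForm.JanusBands
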